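import Summits.RiemannHypothesis.RiemannHypothesis.Theorems.WeilFormatCCinfRowCoeffBox
import Summits.RiemannHypothesis.RiemannHypothesis.Theorems.WeilFormatCCinfRowRemainderBox
import Summits.RiemannHypothesis.RiemannHypothesis.Theorems.WeilFormatCCinfImageRemainderBox
import Literature.NumberTheory.LFunctions.YoshidaWindowGramColumnData
import HarnessLib

/-!
# Format C, design C∞ (E2, data side): the ODD prime-row primitive — boxes of `CinfFam.prowO`, `CinfFam.rhoRowO` and their packed claims

Route context: Fourier–Galerkin / Schur-complement certificates of Weil positivity on a window ("format C", C∞ door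
`weilPositivityOn_of_cinf_pipeline`; supporting stmt-RiemannHypothesis-0098; seat rh-explicit-weil-2, cell memos
`…/rh-explicit-weil-2/gen16/E2F-CERT-PIPELINE.md` §2, `E2F-EMITTER-SPEC.md` §5).  Odd twin of `WeilFormatCCinfCertPrimR` +
`WeilFormatCCinfCertPrimRT`: the row coefficient function `CinfFam.prowO a ν K R J E₀ m₀ : ℕ → Fin 4 × Fin E₀ → ℝ` (kernel index `ii`
↔ mode `ii+1`, rescaling base `m₀+1`) and the truncated remainder `CinfFam.rhoRowO a ν K R J D E₀ m₀` (`WeilFormatCCinfFamilyRowsOdd`)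
are boxed from the landed per-fiber boxes `CinfCoeff.mem_oddRowPureBox` / `mem_oddRowSinBox` (`WeilFormatCCinfRowCoeffBox`),
`mem_oddRowRemBox` (`WeilFormatCCinfRowRemainderBox`) and `CinfCoeff.absBox`; every enclosed function is written VERBATIM as the
door receives it (with `a := (a : ℝ)` for the rung's rational `a`):

* `CinfPrimRO.oddProwBox` / ★ `mem_oddProwBox` — box of `prowO (a:ℝ) ν K R J E₀ m₀ ii (finProdFinEquiv.symm ⟨f, _⟩)` (`0` beyond `4E₀`);
* `oddTailBox` / ★ `mem_oddTailBox`, `oddRhoRowTBox` / ★ `mem_oddRhoRowTBox` — truncation tail and full truncated remainder;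
* ★ `prowDataNearT_odd` (layout `(f, ii)` = `CinfColO.PRN`), ★ `rhoRowTDataNear_odd` (layout `(ii, 0)`) — packed claims from one
  `Encl.checkRect` each.

Bookkeeping over landed evaluators; standard axioms; no RH claim.
-/

set_option autoImplicit false
-- `Summit.RiemannHypothesis.RiemannHypothesis.…` is the layout-mandated namespace (summit = problem name).
set_option linter.dupNamespace false

open Finset Complex
open scoped Real ArithmeticFunction.vonMangoldt

namespace Summit.RiemannHypothesis.RiemannHypothesis.Theorems.WeilFormatC

namespace CinfPrimRO

open Literature.NumberTheory.LFunctions Literature.NumberTheory.LFunctions.Yoshida1992 Literature.Analysis.SpecialFunctions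
open Literature.Analysis.ValidatedNumerics Literature.Analysis.ValidatedNumerics.NumericsMP
open CinfCoeff (RowInputs RowInputsValid oddRowPureBox oddRowSinBox oddRowRemBox mem_oddRowPureBox mem_oddRowSinBox
  mem_oddRowRemBox absBox mem_absBox)

variable {S : ℕ}

/-! ## Generic pieces -/

/-- Reading a four-vector of functions at a `Fin 4` index through its value. -/
private theorem vec4_apply (g₀ g₁ g₂ g₃ : ℕ → ℝ) (t : Fin 4) :
    (![g₀, g₁, g₂, g₃] : Fin 4 → ℕ → ℝ) t
      = if (t : ℕ) = 0 then g₀ else if (t : ℕ) = 1 then g₁ else if (t : ℕ) = 2 then g₂ else g₃ := by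
  fin_cases t <;> rfl

/-- The truncation tail of a four-tag family as four `range` sums. -/
private theorem tail_sum_eq (g₀ g₁ g₂ g₃ : ℕ → ℝ) (τ₀ τ₁ τ₂ τ₃ M : ℝ) (D E₀ : ℕ) :
    (∑ x : Fin 4 × Fin (D + 1), if E₀ < (x.2 : ℕ) then
        |(fun t d ↦ (![g₀, g₁, g₂, g₃] t) d) x.1 x.2| * (![τ₀, τ₁, τ₂, τ₃] x.1) / M ^ (x.2 : ℕ) else 0)
      = (∑ d ∈ Finset.range (D + 1), if E₀ < d then |g₀ d| * τ₀ / M ^ d else 0)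
        + (∑ d ∈ Finset.range (D + 1), if E₀ < d then |g₁ d| * τ₁ / M ^ d else 0)
        + (∑ d ∈ Finset.range (D + 1), if E₀ < d then |g₂ d| * τ₂ / M ^ d else 0)
        + (∑ d ∈ Finset.range (D + 1), if E₀ < d then |g₃ d| * τ₃ / M ^ d else 0) := by
  rw [Fintype.sum_prod_type, Fin.sum_univ_four]
  simp only [Matrix.cons_val_zero, Matrix.cons_val_one, Matrix.cons_val, Finset.sum_range]

/-- `Σ_{j<n} f j` as a box (local copy of the `sumBox` idiom). -/
def sumBox (S : ℕ) (f : ℕ → MI) : ℕ → MI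
  | 0 => MI.ofInt S 0
  | n + 1 => (sumBox S f n).add (f n)

/-- `sumBox ∋ Σ_{j<n} g j`. -/
theorem mem_sumBox (S : ℕ) {f : ℕ → MI} {g : ℕ → ℝ} :
    ∀ n : ℕ, (∀ j < n, MI.mem S (g j) (f j)) → MI.mem S (∑ j ∈ Finset.range n, g j) (sumBox S f n)
  | 0, _ => by simpa [sumBox] using MI.mem_ofInt S 0
  | n + 1, h => by
      rw [Finset.sum_range_succ, sumBox]
      exact MI.mem_add (mem_sumBox S n fun j hj ↦ h j (by omega)) (h n (by omega))

/-- **One tag's truncation tail** `Σ_{d < D+1} (if E₀ < d then |g d|·τ/M^d else 0)` as a box (`M` a natural). -/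
def tagTailBox (S : ℕ) (G : ℕ → MI) (T : MI) (M D E₀ : ℕ) : MI :=
  sumBox S (fun d ↦ if E₀ < d then ((absBox (G d)).mul S T).divNat (M ^ d) else MI.ofInt S 0) (D + 1)

/-- `tagTailBox ∋` the tag's truncation tail. -/
theorem mem_tagTailBox (hS : 0 < S) {g : ℕ → ℝ} {G : ℕ → MI} (hg : ∀ d, MI.mem S (g d) (G d)) {τ : ℝ} {T : MI}
    (hτ : MI.mem S τ T) {M : ℕ} (hM : 0 < M) (D E₀ : ℕ) :
    MI.mem S (∑ d ∈ Finset.range (D + 1), if E₀ < d then |g d| * τ / (M : ℝ) ^ d else 0) (tagTailBox S G T M D E₀) := by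
  refine mem_sumBox S (D + 1) fun d _ ↦ ?_
  by_cases h : E₀ < d
  · rw [if_pos h, if_pos h]
    have h1 := MI.mem_divNat (MI.mem_mul hS (mem_absBox (hg d)) hτ) (pow_pos hM d)
    simpa only [Nat.cast_pow, mul_div_assoc] using h1
  · rw [if_neg h, if_neg h]
    simpa using MI.mem_ofInt S 0

/-! ## The row coefficient entries -/

/-- **Box of the odd row coefficient** `prowO … ii (f / E₀, f % E₀)` (`0` beyond `f < 4E₀`): tag `0` → `P₁(ii+1, e+1)/(m₀+1)^{e+1}`,
tags `1, 2` → `0`, tag `3` → `P_S(ii+1, e+1)/(m₀+1)^{e+1}`, `e = f % E₀`. -/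
def oddProwBox (S : ℕ) (X : ℕ → RowInputs) (ν K R J E₀ m₀ ii f : ℕ) : MI :=
  if f < 4 * E₀ then
    (if f / E₀ = 0 then oddRowPureBox S (X ii) (ii + 1) ν K R J (f % E₀ + 1)
      else if f / E₀ = 1 then MI.ofInt S 0 else if f / E₀ = 2 then MI.ofInt S 0
      else oddRowSinBox S (X ii) (ii + 1) J (f % E₀ + 1)).divNat ((m₀ + 1) ^ (f % E₀ + 1))
  else MI.ofInt S 0

variable {a : ℚ} {X : ℕ → RowInputs} {ν K R J D E₀ m₀ : ℕ} {Lam RemS Rho : MI}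

/-- ★ **`oddProwBox ∋ prowO (a:ℝ) ν K R J E₀ m₀ ii (finProdFinEquiv.symm f)`** — the door's printed odd row coefficient, flattened;
`0` for `f ≥ 4E₀`. -/
theorem mem_oddProwBox (hS : 0 < S) (ha : 0 < a) {ii : ℕ}
    (hX : RowInputsValid S a (ii + 1) ν R (freq (a : ℝ) ((ii + 1 : ℕ) : ℤ) / (1 + 4 * freq (a : ℝ) ((ii + 1 : ℕ) : ℤ) ^ 2)) (X ii)) (f : ℕ) :
    MI.mem S
      (if h : f < 4 * E₀ then
        (fun (ii : ℕ) (x : Fin 4 × Fin E₀) ↦ ((![fun d : ℕ ↦ (∑ j ∈ (Finset.range J).filter (fun j ↦ (2 * j + 2) = d),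
                         π / 4 * ((-1 : ℝ) ^ (ii + 1) * ((ii + 1 : ℕ) : ℝ) ^ (2 * j + 1)) / Real.pi)
                       + (∑ p ∈ (Finset.Icc 1 K ×ˢ Finset.range J).filter (fun p ↦ p.1 + (2 * p.2 + 2) = d),
                           (fun N : ℕ ↦ (if N % 4 = 1 then (1 : ℝ) else if N % 4 = 3 then -1 else 0)
                       * (1 - 1 / (2 * (N : ℝ))
                           - (∑ l ∈ Finset.Icc 1 ν, (bernoulli (2 * l) : ℝ) / (2 * l) * 16 ^ l
                               * (((N - 1).choose (2 * l - 1) : ℕ) : ℝ)) / 2)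
                       * ((a : ℝ) / (2 * π)) ^ N) p.1
                             * ((-1 : ℝ) ^ (ii + 1) * ((ii + 1 : ℕ) : ℝ) ^ (2 * p.2 + 1)) / Real.pi)
                       - (∑ p ∈ (Finset.range R ×ˢ Finset.range J).filter (fun p ↦ (2 * p.1 + 1) + (2 * p.2 + 2) = d),
                           (fun r : ℕ ↦ (-1 : ℝ) ^ r *
                       (∑' l : ℕ, Real.exp (-(2 * (a : ℝ) * digammaNode l)) * digammaNode l ^ (2 * r)) * ((a : ℝ) / π) ^ (2 * r + 1)) p.1
                             * ((-1 : ℝ) ^ (ii + 1) * ((ii + 1 : ℕ) : ℝ) ^ (2 * p.2 + 1)) / Real.pi)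
                       + (∑ r ∈ (Finset.range J).filter (fun r ↦ (2 * r + 1) = d),
                           (fun r : ℕ ↦ (-1 : ℝ) ^ (ii + 1) *
                       (-(((ii + 1 : ℕ) : ℝ) ^ (2 * r)) * ((Complex.digamma (1 / 4 + ((freq (a : ℝ) ((ii + 1 : ℕ) : ℤ) : ℝ) : ℂ) / 2 * I)).im / 2
                           + (∑ k ∈ weilPrimeIndex (a : ℝ), (Λ k : ℝ) / Real.sqrt k * Real.sin (freq (a : ℝ) ((ii + 1 : ℕ) : ℤ) * Real.log k))
                           - archExpSumSin (a : ℝ) ((ii + 1 : ℕ) : ℤ)) / π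
                         - 4 * (Real.exp ((a : ℝ) / 2) - Real.exp (-((a : ℝ) / 2))) ^ 2 / π * (-1 : ℝ) ^ r * ((a : ℝ) ^ 2 / (4 * π ^ 2)) ^ r
                           * (freq (a : ℝ) ((ii + 1 : ℕ) : ℤ) / (1 + 4 * freq (a : ℝ) ((ii + 1 : ℕ) : ℤ) ^ 2)))) r),
                         fun _ ↦ 0, fun _ ↦ 0,
                         fun d : ℕ ↦ ∑ j ∈ (Finset.range J).filter (fun j ↦ (2 * j + 2) = d),
                         ((-1 : ℝ) ^ (ii + 1) * ((ii + 1 : ℕ) : ℝ) ^ (2 * j + 1)) / Real.pi] x.1) ((x.2 : ℕ) + 1) / ((m₀ + 1 : ℕ) : ℝ) ^ ((x.2 : ℕ) + 1))) ii (finProdFinEquiv.symm ⟨f, h⟩)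
       else 0)
      (oddProwBox S X ν K R J E₀ m₀ ii f) := by
  by_cases h : f < 4 * E₀
  · rw [dif_pos h, oddProwBox, if_pos h, finProdFinEquiv_symm_apply]
    simp only [vec4_apply, Fin.coe_divNat, Fin.coe_modNat]
    have hpow : (0 : ℕ) < (m₀ + 1) ^ (f % E₀ + 1) := pow_pos (Nat.succ_pos m₀) _
    by_cases h0 : f / E₀ = 0
    · rw [if_pos h0, if_pos h0]
      have h1 := MI.mem_divNat (mem_oddRowPureBox hS ha hX K J (f % E₀ + 1)) hpow
      convert h1 using 2
      norm_cast
    · rw [if_neg h0, if_neg h0]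
      by_cases h1 : f / E₀ = 1
      · rw [if_pos h1, if_pos h1]
        simpa using MI.mem_divNat (MI.mem_ofInt S 0) hpow
      · rw [if_neg h1, if_neg h1]
        by_cases h2 : f / E₀ = 2
        · rw [if_pos h2, if_pos h2]
          simpa using MI.mem_divNat (MI.mem_ofInt S 0) hpow
        · rw [if_neg h2, if_neg h2]
          have h3 := MI.mem_divNat (mem_oddRowSinBox hX J (f % E₀ + 1)) hpow
          convert h3 using 2
          norm_cast
  · rw [dif_neg h, oddProwBox, if_neg h]
    simpa using MI.mem_ofInt S 0

/-! ## The truncation tail and the full truncated remainder -/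

/-- **Box of the odd truncation tail** of kernel row `ii`: tags `0`, `3` from the per-fiber boxes at mode `ii+1`, tags `1, 2`
identically zero; weights `![1, m₀+1, ΣΛ/√n, ΣΛ/√n]`, base `m₀+1`. -/
def oddTailBox (S : ℕ) (X : ℕ → RowInputs) (Lam : MI) (ν K R J m₀ D E₀ ii : ℕ) : MI :=
  (((tagTailBox S (fun d ↦ oddRowPureBox S (X ii) (ii + 1) ν K R J d) (MI.ofInt S 1) (m₀ + 1) D E₀).add
      (tagTailBox S (fun _ ↦ MI.ofInt S 0) (MI.ofInt S ((m₀ + 1 : ℕ) : ℤ)) (m₀ + 1) D E₀)).add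
      (tagTailBox S (fun _ ↦ MI.ofInt S 0) Lam (m₀ + 1) D E₀)).add
    (tagTailBox S (fun d ↦ oddRowSinBox S (X ii) (ii + 1) J d) Lam (m₀ + 1) D E₀)

/-- ★ **`oddTailBox ∋` the truncation tail of `CinfFam.rhoRowO`** (verbatim with `a := (a : ℝ)`). -/
theorem mem_oddTailBox (hS : 0 < S) (ha : 0 < a) {ii : ℕ}
    (hX : RowInputsValid S a (ii + 1) ν R (freq (a : ℝ) ((ii + 1 : ℕ) : ℤ) / (1 + 4 * freq (a : ℝ) ((ii + 1 : ℕ) : ℤ) ^ 2)) (X ii))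
    (hLam : MI.mem S (∑ k ∈ weilPrimeIndex (a : ℝ), (Λ k : ℝ) / Real.sqrt k) Lam) :
    MI.mem S
      (∑ x : Fin 4 × Fin (D + 1), if E₀ < (x.2 : ℕ) then
                |(fun t d ↦ (![fun d : ℕ ↦ (∑ j ∈ (Finset.range J).filter (fun j ↦ (2 * j + 2) = d),
                      π / 4 * ((-1 : ℝ) ^ (ii + 1) * ((ii + 1 : ℕ) : ℝ) ^ (2 * j + 1)) / Real.pi)
                    + (∑ p ∈ (Finset.Icc 1 K ×ˢ Finset.range J).filter (fun p ↦ p.1 + (2 * p.2 + 2) = d),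
                        (fun N : ℕ ↦ (if N % 4 = 1 then (1 : ℝ) else if N % 4 = 3 then -1 else 0)
                    * (1 - 1 / (2 * (N : ℝ))
                        - (∑ l ∈ Finset.Icc 1 ν, (bernoulli (2 * l) : ℝ) / (2 * l) * 16 ^ l
                            * (((N - 1).choose (2 * l - 1) : ℕ) : ℝ)) / 2)
                    * ((a : ℝ) / (2 * π)) ^ N) p.1
                          * ((-1 : ℝ) ^ (ii + 1) * ((ii + 1 : ℕ) : ℝ) ^ (2 * p.2 + 1)) / Real.pi)
                    - (∑ p ∈ (Finset.range R ×ˢ Finset.range J).filter (fun p ↦ (2 * p.1 + 1) + (2 * p.2 + 2) = d),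
                        (fun r : ℕ ↦ (-1 : ℝ) ^ r *
                    (∑' l : ℕ, Real.exp (-(2 * (a : ℝ) * digammaNode l)) * digammaNode l ^ (2 * r)) * ((a : ℝ) / π) ^ (2 * r + 1)) p.1
                          * ((-1 : ℝ) ^ (ii + 1) * ((ii + 1 : ℕ) : ℝ) ^ (2 * p.2 + 1)) / Real.pi)
                    + (∑ r ∈ (Finset.range J).filter (fun r ↦ (2 * r + 1) = d),
                        (fun r : ℕ ↦ (-1 : ℝ) ^ (ii + 1) *
                    (-(((ii + 1 : ℕ) : ℝ) ^ (2 * r)) * ((Complex.digamma (1 / 4 + ((freq (a : ℝ) ((ii + 1 : ℕ) : ℤ) : ℝ) : ℂ) / 2 * I)).im / 2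
                        + (∑ k ∈ weilPrimeIndex (a : ℝ), (Λ k : ℝ) / Real.sqrt k * Real.sin (freq (a : ℝ) ((ii + 1 : ℕ) : ℤ) * Real.log k))
                        - archExpSumSin (a : ℝ) ((ii + 1 : ℕ) : ℤ)) / π
                      - 4 * (Real.exp ((a : ℝ) / 2) - Real.exp (-((a : ℝ) / 2))) ^ 2 / π * (-1 : ℝ) ^ r * ((a : ℝ) ^ 2 / (4 * π ^ 2)) ^ r
                        * (freq (a : ℝ) ((ii + 1 : ℕ) : ℤ) / (1 + 4 * freq (a : ℝ) ((ii + 1 : ℕ) : ℤ) ^ 2)))) r),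
                      fun _ ↦ 0, fun _ ↦ 0,
                      fun d : ℕ ↦ ∑ j ∈ (Finset.range J).filter (fun j ↦ (2 * j + 2) = d),
                      ((-1 : ℝ) ^ (ii + 1) * ((ii + 1 : ℕ) : ℝ) ^ (2 * j + 1)) / Real.pi] t) d) x.1 x.2| * (![(1 : ℝ), ((m₀ + 1 : ℕ) : ℝ), ∑ n ∈ weilPrimeIndex (a : ℝ), (Λ n : ℝ) / Real.sqrt n, ∑ n ∈ weilPrimeIndex (a : ℝ), (Λ n : ℝ) / Real.sqrt n] x.1) / ((m₀ + 1 : ℕ) : ℝ) ^ (x.2 : ℕ) else 0)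
      (oddTailBox S X Lam ν K R J m₀ D E₀ ii) := by
  rw [tail_sum_eq, oddTailBox]
  refine MI.mem_add (MI.mem_add (MI.mem_add ?_ ?_) ?_) ?_
  · exact mem_tagTailBox hS (fun d ↦ mem_oddRowPureBox hS ha hX K J d) (by exact_mod_cast MI.mem_ofInt S 1)
      (Nat.succ_pos m₀) D E₀
  · exact mem_tagTailBox hS (fun _ ↦ by exact_mod_cast MI.mem_ofInt S 0)
      (by exact_mod_cast MI.mem_ofInt S ((m₀ + 1 : ℕ) : ℤ)) (Nat.succ_pos m₀) D E₀
  · exact mem_tagTailBox hS (fun _ ↦ by exact_mod_cast MI.mem_ofInt S 0) hLam (Nat.succ_pos m₀) D E₀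
  · exact mem_tagTailBox hS (fun d ↦ mem_oddRowSinBox hX J d) hLam (Nat.succ_pos m₀) D E₀

/-- **Box of `CinfFam.rhoRowO (a:ℝ) ν K R J D E₀ m₀ ii`**: analytic remainder (`CinfCoeff.oddRowRemBox` at mode `ii+1`, base
`m₀+1`) plus truncation tail. -/
def oddRhoRowTBox (S : ℕ) (X : ℕ → RowInputs) (RemS Lam Rho : MI) (a : ℚ) (ν K R J m₀ D E₀ ii : ℕ) : MI :=
  (oddRowRemBox S RemS (X ii).P (X ii).Pinv Lam Rho (X ii).S2 (X ii).QQ (X ii).Ci a (ii + 1) (m₀ + 1) J).add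
    (oddTailBox S X Lam ν K R J m₀ D E₀ ii)

/-- ★ **`oddRhoRowTBox ∋ CinfFam.rhoRowO (a:ℝ) ν K R J D E₀ m₀ ii`** (printed verbatim; inputs: the row's `RowInputs` at mode
`ii+1`, `RemS ∋` the Stirling/node bracket at base `m₀+1`, `Lam ∋ Σ Λ(k)/√k`, `Rho ∋ ρ(2a)`). -/
theorem mem_oddRhoRowTBox (hS : 0 < S) (ha : 0 < a) {ii : ℕ}
    (hX : RowInputsValid S a (ii + 1) ν R (freq (a : ℝ) ((ii + 1 : ℕ) : ℤ) / (1 + 4 * freq (a : ℝ) ((ii + 1 : ℕ) : ℤ) ^ 2)) (X ii))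
    (hRemS : MI.mem S
      ((4 * Real.pi ^ 2 / 3 * ((2 * ν + 1).factorial : ℝ) / (2 * Real.pi) ^ (2 * ν + 1)
                  * (4 * (1 / (4 * (π * ((m₀ + 1 : ℕ) : ℝ) / (a : ℝ) / 2)))) ^ (2 * ν)
                + (1 / (4 * (π * ((m₀ + 1 : ℕ) : ℝ) / (a : ℝ) / 2))) ^ (K + 1) / ((K + 1) * (1 - 1 / (4 * (π * ((m₀ + 1 : ℕ) : ℝ) / (a : ℝ) / 2))))
                + 2 * (1 / (4 * (π * ((m₀ + 1 : ℕ) : ℝ) / (a : ℝ) / 2))) ^ (K + 1)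
                + ∑ k ∈ Finset.Icc 1 ν, |(bernoulli (2 * k) : ℝ) / (2 * k)| * 2 ^ (K + 1 + 4 * k)
                    * (1 / (4 * (π * ((m₀ + 1 : ℕ) : ℝ) / (a : ℝ) / 2))) ^ (K + 1)) / 2
              + (∑' k : ℕ, Real.exp (-(2 * (a : ℝ) * digammaNode k)) * digammaNode k ^ (2 * R))
                  / |π * ((m₀ + 1 : ℕ) : ℝ) / (a : ℝ)| ^ (2 * R + 1)) RemS)
    (hLam : MI.mem S (∑ k ∈ weilPrimeIndex (a : ℝ), (Λ k : ℝ) / Real.sqrt k) Lam)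
    (hRho : MI.mem S (weilArchDensity (2 * (a : ℝ))) Rho) :
    MI.mem S
      ((((4 * Real.pi ^ 2 / 3 * ((2 * ν + 1).factorial : ℝ) / (2 * Real.pi) ^ (2 * ν + 1)
                       * (4 * (1 / (4 * (π * ((m₀ + 1 : ℕ) : ℝ) / (a : ℝ) / 2)))) ^ (2 * ν)
                     + (1 / (4 * (π * ((m₀ + 1 : ℕ) : ℝ) / (a : ℝ) / 2))) ^ (K + 1) / ((K + 1) * (1 - 1 / (4 * (π * ((m₀ + 1 : ℕ) : ℝ) / (a : ℝ) / 2))))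
                     + 2 * (1 / (4 * (π * ((m₀ + 1 : ℕ) : ℝ) / (a : ℝ) / 2))) ^ (K + 1)
                     + ∑ k ∈ Finset.Icc 1 ν, |(bernoulli (2 * k) : ℝ) / (2 * k)| * 2 ^ (K + 1 + 4 * k)
                         * (1 / (4 * (π * ((m₀ + 1 : ℕ) : ℝ) / (a : ℝ) / 2))) ^ (K + 1)) / 2
                   + (∑' k : ℕ, Real.exp (-(2 * (a : ℝ) * digammaNode k)) * digammaNode k ^ (2 * R))
                       / |π * ((m₀ + 1 : ℕ) : ℝ) / (a : ℝ)| ^ (2 * R + 1)) / π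
                   * ∑ j ∈ Finset.range J, ((ii + 1 : ℕ) : ℝ) ^ (2 * j + 1) / ((m₀ + 1 : ℕ) : ℝ) ^ (2 * j + 2)
                 + (2 * (π / 4 + (∑ k ∈ weilPrimeIndex (a : ℝ), (Λ k : ℝ) / Real.sqrt k) + (a : ℝ) * (1 + weilArchDensity (2 * (a : ℝ))) / π)
                       * ((ii + 1 : ℕ) : ℝ) ^ (2 * J) / π
                     + 4 * (Real.exp ((a : ℝ) / 2) - Real.exp (-((a : ℝ) / 2))) ^ 2 / π * ((a : ℝ) ^ 2 / (4 * π ^ 2)) ^ J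
                       * (freq (a : ℝ) ((ii + 1 : ℕ) : ℤ) / (1 + 4 * freq (a : ℝ) ((ii + 1 : ℕ) : ℤ) ^ 2))) / ((m₀ + 1 : ℕ) : ℝ) ^ (2 * J + 1))
        + ∑ x : Fin 4 × Fin (D + 1), if E₀ < (x.2 : ℕ) then
                  |(fun t d ↦ (![fun d : ℕ ↦ (∑ j ∈ (Finset.range J).filter (fun j ↦ (2 * j + 2) = d),
                        π / 4 * ((-1 : ℝ) ^ (ii + 1) * ((ii + 1 : ℕ) : ℝ) ^ (2 * j + 1)) / Real.pi)
                      + (∑ p ∈ (Finset.Icc 1 K ×ˢ Finset.range J).filter (fun p ↦ p.1 + (2 * p.2 + 2) = d),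
                          (fun N : ℕ ↦ (if N % 4 = 1 then (1 : ℝ) else if N % 4 = 3 then -1 else 0)
                      * (1 - 1 / (2 * (N : ℝ))
                          - (∑ l ∈ Finset.Icc 1 ν, (bernoulli (2 * l) : ℝ) / (2 * l) * 16 ^ l
                              * (((N - 1).choose (2 * l - 1) : ℕ) : ℝ)) / 2)
                      * ((a : ℝ) / (2 * π)) ^ N) p.1
                            * ((-1 : ℝ) ^ (ii + 1) * ((ii + 1 : ℕ) : ℝ) ^ (2 * p.2 + 1)) / Real.pi)
                      - (∑ p ∈ (Finset.range R ×ˢ Finset.range J).filter (fun p ↦ (2 * p.1 + 1) + (2 * p.2 + 2) = d),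
                          (fun r : ℕ ↦ (-1 : ℝ) ^ r *
                      (∑' l : ℕ, Real.exp (-(2 * (a : ℝ) * digammaNode l)) * digammaNode l ^ (2 * r)) * ((a : ℝ) / π) ^ (2 * r + 1)) p.1
                            * ((-1 : ℝ) ^ (ii + 1) * ((ii + 1 : ℕ) : ℝ) ^ (2 * p.2 + 1)) / Real.pi)
                      + (∑ r ∈ (Finset.range J).filter (fun r ↦ (2 * r + 1) = d),
                          (fun r : ℕ ↦ (-1 : ℝ) ^ (ii + 1) *
                      (-(((ii + 1 : ℕ) : ℝ) ^ (2 * r)) * ((Complex.digamma (1 / 4 + ((freq (a : ℝ) ((ii + 1 : ℕ) : ℤ) : ℝ) : ℂ) / 2 * I)).im / 2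
                          + (∑ k ∈ weilPrimeIndex (a : ℝ), (Λ k : ℝ) / Real.sqrt k * Real.sin (freq (a : ℝ) ((ii + 1 : ℕ) : ℤ) * Real.log k))
                          - archExpSumSin (a : ℝ) ((ii + 1 : ℕ) : ℤ)) / π
                        - 4 * (Real.exp ((a : ℝ) / 2) - Real.exp (-((a : ℝ) / 2))) ^ 2 / π * (-1 : ℝ) ^ r * ((a : ℝ) ^ 2 / (4 * π ^ 2)) ^ r
                          * (freq (a : ℝ) ((ii + 1 : ℕ) : ℤ) / (1 + 4 * freq (a : ℝ) ((ii + 1 : ℕ) : ℤ) ^ 2)))) r),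
                        fun _ ↦ 0, fun _ ↦ 0,
                        fun d : ℕ ↦ ∑ j ∈ (Finset.range J).filter (fun j ↦ (2 * j + 2) = d),
                        ((-1 : ℝ) ^ (ii + 1) * ((ii + 1 : ℕ) : ℝ) ^ (2 * j + 1)) / Real.pi] t) d) x.1 x.2| * (![(1 : ℝ), ((m₀ + 1 : ℕ) : ℝ), ∑ n ∈ weilPrimeIndex (a : ℝ), (Λ n : ℝ) / Real.sqrt n, ∑ n ∈ weilPrimeIndex (a : ℝ), (Λ n : ℝ) / Real.sqrt n] x.1) / ((m₀ + 1 : ℕ) : ℝ) ^ (x.2 : ℕ) else 0)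
      (oddRhoRowTBox S X RemS Lam Rho a ν K R J m₀ D E₀ ii) := by
  have h1 := mem_oddRowRemBox hS (a := a) (m₀ := m₀ + 1) (Nat.succ_pos m₀) J hRemS hX.hP hX.hPinv hLam hRho hX.hS2 hX.hQQ
    hX.hCi (i := ii + 1)
  have h2 := mem_oddTailBox (K := K) (J := J) (D := D) (E₀ := E₀) (m₀ := m₀) hS ha hX hLam
  have h := MI.mem_add h1 h2
  rw [oddRhoRowTBox]
  convert h using 2

/-! ## Packed claims -/

/-- Local copy of `CinfPrimV.dataNear_of_checkRect`. -/
private theorem dataNear_of_checkRect (hS : 0 < S) {f : ℕ → ℕ → ℝ} {box : ℕ → ℕ → MI} {n K w o c ρ : ℕ} {XP : List ℕ}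
    (hbox : ∀ i < n, ∀ t < K, MI.mem S (f i t) (box i t))
    (h : Encl.checkRect S c (ρ : ℤ) w K o box XP 0 n 0 K = true) : Encl.DataNear f n K w o c ρ XP := by
  have h0 : Encl.DataNear f (0 + n) K w o c ρ XP :=
    Encl.DataNear.extendRows Encl.DataNear.zeroRows fun i _ hi t ht ↦ by
      have h2 := Encl.near_of_checkRect hS (f := f)
        (fun i _ hi t _ ht ↦ hbox i (by simpa using hi) t (by simpa using ht)) h (Nat.zero_le i) hi
        (Nat.zero_le t) (by simpa using ht)
      exact_mod_cast h2
  simpa using h0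

variable {B : ℕ}

/-- ★ **Packed claim of the odd row coefficients, TRANSPOSED layout** `(f, ii)` (`4E₀` rows, `B` digits; = `CinfColO.PRN`). -/
theorem prowDataNearT_odd (hS : 0 < S) (ha : 0 < a)
    (hX : ∀ ii < B, RowInputsValid S a (ii + 1) ν R (freq (a : ℝ) ((ii + 1 : ℕ) : ℤ) / (1 + 4 * freq (a : ℝ) ((ii + 1 : ℕ) : ℤ) ^ 2)) (X ii))
    {w o cc ρ : ℕ} {XP : List ℕ}
    (h : Encl.checkRect S cc (ρ : ℤ) w B o (fun f ii ↦ oddProwBox S X ν K R J E₀ m₀ ii f) XP 0 (4 * E₀) 0 B = true) :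
    Encl.DataNear (fun f ii ↦ if h : f < 4 * E₀ then
        (fun (ii : ℕ) (x : Fin 4 × Fin E₀) ↦ ((![fun d : ℕ ↦ (∑ j ∈ (Finset.range J).filter (fun j ↦ (2 * j + 2) = d),
                         π / 4 * ((-1 : ℝ) ^ (ii + 1) * ((ii + 1 : ℕ) : ℝ) ^ (2 * j + 1)) / Real.pi)
                       + (∑ p ∈ (Finset.Icc 1 K ×ˢ Finset.range J).filter (fun p ↦ p.1 + (2 * p.2 + 2) = d),
                           (fun N : ℕ ↦ (if N % 4 = 1 then (1 : ℝ) else if N % 4 = 3 then -1 else 0)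
                       * (1 - 1 / (2 * (N : ℝ))
                           - (∑ l ∈ Finset.Icc 1 ν, (bernoulli (2 * l) : ℝ) / (2 * l) * 16 ^ l
                               * (((N - 1).choose (2 * l - 1) : ℕ) : ℝ)) / 2)
                       * ((a : ℝ) / (2 * π)) ^ N) p.1
                             * ((-1 : ℝ) ^ (ii + 1) * ((ii + 1 : ℕ) : ℝ) ^ (2 * p.2 + 1)) / Real.pi)
                       - (∑ p ∈ (Finset.range R ×ˢ Finset.range J).filter (fun p ↦ (2 * p.1 + 1) + (2 * p.2 + 2) = d),
                           (fun r : ℕ ↦ (-1 : ℝ) ^ r *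
                       (∑' l : ℕ, Real.exp (-(2 * (a : ℝ) * digammaNode l)) * digammaNode l ^ (2 * r)) * ((a : ℝ) / π) ^ (2 * r + 1)) p.1
                             * ((-1 : ℝ) ^ (ii + 1) * ((ii + 1 : ℕ) : ℝ) ^ (2 * p.2 + 1)) / Real.pi)
                       + (∑ r ∈ (Finset.range J).filter (fun r ↦ (2 * r + 1) = d),
                           (fun r : ℕ ↦ (-1 : ℝ) ^ (ii + 1) *
                       (-(((ii + 1 : ℕ) : ℝ) ^ (2 * r)) * ((Complex.digamma (1 / 4 + ((freq (a : ℝ) ((ii + 1 : ℕ) : ℤ) : ℝ) : ℂ) / 2 * I)).im / 2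
                           + (∑ k ∈ weilPrimeIndex (a : ℝ), (Λ k : ℝ) / Real.sqrt k * Real.sin (freq (a : ℝ) ((ii + 1 : ℕ) : ℤ) * Real.log k))
                           - archExpSumSin (a : ℝ) ((ii + 1 : ℕ) : ℤ)) / π
                         - 4 * (Real.exp ((a : ℝ) / 2) - Real.exp (-((a : ℝ) / 2))) ^ 2 / π * (-1 : ℝ) ^ r * ((a : ℝ) ^ 2 / (4 * π ^ 2)) ^ r
                           * (freq (a : ℝ) ((ii + 1 : ℕ) : ℤ) / (1 + 4 * freq (a : ℝ) ((ii + 1 : ℕ) : ℤ) ^ 2)))) r),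
                         fun _ ↦ 0, fun _ ↦ 0,
                         fun d : ℕ ↦ ∑ j ∈ (Finset.range J).filter (fun j ↦ (2 * j + 2) = d),
                         ((-1 : ℝ) ^ (ii + 1) * ((ii + 1 : ℕ) : ℝ) ^ (2 * j + 1)) / Real.pi] x.1) ((x.2 : ℕ) + 1) / ((m₀ + 1 : ℕ) : ℝ) ^ ((x.2 : ℕ) + 1))) ii (finProdFinEquiv.symm ⟨f, h⟩)
       else 0) (4 * E₀) B w o cc ρ XP :=
  dataNear_of_checkRect hS (fun f _ ii hii ↦ mem_oddProwBox hS ha (hX ii hii) f) h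

/-- ★ **Packed claim of the truncated odd row remainders** `CinfFam.rhoRowO (a:ℝ) ν K R J D E₀ m₀ ii`, layout `(ii, 0)`. -/
theorem rhoRowTDataNear_odd (hS : 0 < S) (ha : 0 < a)
    (hX : ∀ ii < B, RowInputsValid S a (ii + 1) ν R (freq (a : ℝ) ((ii + 1 : ℕ) : ℤ) / (1 + 4 * freq (a : ℝ) ((ii + 1 : ℕ) : ℤ) ^ 2)) (X ii))
    (hRemS : MI.mem S
      ((4 * Real.pi ^ 2 / 3 * ((2 * ν + 1).factorial : ℝ) / (2 * Real.pi) ^ (2 * ν + 1)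
                  * (4 * (1 / (4 * (π * ((m₀ + 1 : ℕ) : ℝ) / (a : ℝ) / 2)))) ^ (2 * ν)
                + (1 / (4 * (π * ((m₀ + 1 : ℕ) : ℝ) / (a : ℝ) / 2))) ^ (K + 1) / ((K + 1) * (1 - 1 / (4 * (π * ((m₀ + 1 : ℕ) : ℝ) / (a : ℝ) / 2))))
                + 2 * (1 / (4 * (π * ((m₀ + 1 : ℕ) : ℝ) / (a : ℝ) / 2))) ^ (K + 1)
                + ∑ k ∈ Finset.Icc 1 ν, |(bernoulli (2 * k) : ℝ) / (2 * k)| * 2 ^ (K + 1 + 4 * k)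
                    * (1 / (4 * (π * ((m₀ + 1 : ℕ) : ℝ) / (a : ℝ) / 2))) ^ (K + 1)) / 2
              + (∑' k : ℕ, Real.exp (-(2 * (a : ℝ) * digammaNode k)) * digammaNode k ^ (2 * R))
                  / |π * ((m₀ + 1 : ℕ) : ℝ) / (a : ℝ)| ^ (2 * R + 1)) RemS)
    (hLam : MI.mem S (∑ k ∈ weilPrimeIndex (a : ℝ), (Λ k : ℝ) / Real.sqrt k) Lam)
    (hRho : MI.mem S (weilArchDensity (2 * (a : ℝ))) Rho) {w o cc ρ : ℕ} {XP : List ℕ}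
    (h : Encl.checkRect S cc (ρ : ℤ) w 1 o (fun ii _ ↦ oddRhoRowTBox S X RemS Lam Rho a ν K R J m₀ D E₀ ii) XP 0 B 0 1 = true) :
    Encl.DataNear (fun ii _ ↦ (fun ii : ℕ ↦ (((4 * Real.pi ^ 2 / 3 * ((2 * ν + 1).factorial : ℝ) / (2 * Real.pi) ^ (2 * ν + 1)
                        * (4 * (1 / (4 * (π * ((m₀ + 1 : ℕ) : ℝ) / (a : ℝ) / 2)))) ^ (2 * ν)
                      + (1 / (4 * (π * ((m₀ + 1 : ℕ) : ℝ) / (a : ℝ) / 2))) ^ (K + 1) / ((K + 1) * (1 - 1 / (4 * (π * ((m₀ + 1 : ℕ) : ℝ) / (a : ℝ) / 2))))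
                      + 2 * (1 / (4 * (π * ((m₀ + 1 : ℕ) : ℝ) / (a : ℝ) / 2))) ^ (K + 1)
                      + ∑ k ∈ Finset.Icc 1 ν, |(bernoulli (2 * k) : ℝ) / (2 * k)| * 2 ^ (K + 1 + 4 * k)
                          * (1 / (4 * (π * ((m₀ + 1 : ℕ) : ℝ) / (a : ℝ) / 2))) ^ (K + 1)) / 2
                    + (∑' k : ℕ, Real.exp (-(2 * (a : ℝ) * digammaNode k)) * digammaNode k ^ (2 * R))
                        / |π * ((m₀ + 1 : ℕ) : ℝ) / (a : ℝ)| ^ (2 * R + 1)) / π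
                    * ∑ j ∈ Finset.range J, ((ii + 1 : ℕ) : ℝ) ^ (2 * j + 1) / ((m₀ + 1 : ℕ) : ℝ) ^ (2 * j + 2)
                  + (2 * (π / 4 + (∑ k ∈ weilPrimeIndex (a : ℝ), (Λ k : ℝ) / Real.sqrt k) + (a : ℝ) * (1 + weilArchDensity (2 * (a : ℝ))) / π)
                        * ((ii + 1 : ℕ) : ℝ) ^ (2 * J) / π
                      + 4 * (Real.exp ((a : ℝ) / 2) - Real.exp (-((a : ℝ) / 2))) ^ 2 / π * ((a : ℝ) ^ 2 / (4 * π ^ 2)) ^ J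
                        * (freq (a : ℝ) ((ii + 1 : ℕ) : ℤ) / (1 + 4 * freq (a : ℝ) ((ii + 1 : ℕ) : ℤ) ^ 2))) / ((m₀ + 1 : ℕ) : ℝ) ^ (2 * J + 1))
        + ∑ x : Fin 4 × Fin (D + 1), if E₀ < (x.2 : ℕ) then
                  |(fun t d ↦ (![fun d : ℕ ↦ (∑ j ∈ (Finset.range J).filter (fun j ↦ (2 * j + 2) = d),
                        π / 4 * ((-1 : ℝ) ^ (ii + 1) * ((ii + 1 : ℕ) : ℝ) ^ (2 * j + 1)) / Real.pi)
                      + (∑ p ∈ (Finset.Icc 1 K ×ˢ Finset.range J).filter (fun p ↦ p.1 + (2 * p.2 + 2) = d),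
                          (fun N : ℕ ↦ (if N % 4 = 1 then (1 : ℝ) else if N % 4 = 3 then -1 else 0)
                      * (1 - 1 / (2 * (N : ℝ))
                          - (∑ l ∈ Finset.Icc 1 ν, (bernoulli (2 * l) : ℝ) / (2 * l) * 16 ^ l
                              * (((N - 1).choose (2 * l - 1) : ℕ) : ℝ)) / 2)
                      * ((a : ℝ) / (2 * π)) ^ N) p.1
                            * ((-1 : ℝ) ^ (ii + 1) * ((ii + 1 : ℕ) : ℝ) ^ (2 * p.2 + 1)) / Real.pi)
                      - (∑ p ∈ (Finset.range R ×ˢ Finset.range J).filter (fun p ↦ (2 * p.1 + 1) + (2 * p.2 + 2) = d),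
                          (fun r : ℕ ↦ (-1 : ℝ) ^ r *
                      (∑' l : ℕ, Real.exp (-(2 * (a : ℝ) * digammaNode l)) * digammaNode l ^ (2 * r)) * ((a : ℝ) / π) ^ (2 * r + 1)) p.1
                            * ((-1 : ℝ) ^ (ii + 1) * ((ii + 1 : ℕ) : ℝ) ^ (2 * p.2 + 1)) / Real.pi)
                      + (∑ r ∈ (Finset.range J).filter (fun r ↦ (2 * r + 1) = d),
                          (fun r : ℕ ↦ (-1 : ℝ) ^ (ii + 1) *
                      (-(((ii + 1 : ℕ) : ℝ) ^ (2 * r)) * ((Complex.digamma (1 / 4 + ((freq (a : ℝ) ((ii + 1 : ℕ) : ℤ) : ℝ) : ℂ) / 2 * I)).im / 2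
                          + (∑ k ∈ weilPrimeIndex (a : ℝ), (Λ k : ℝ) / Real.sqrt k * Real.sin (freq (a : ℝ) ((ii + 1 : ℕ) : ℤ) * Real.log k))
                          - archExpSumSin (a : ℝ) ((ii + 1 : ℕ) : ℤ)) / π
                        - 4 * (Real.exp ((a : ℝ) / 2) - Real.exp (-((a : ℝ) / 2))) ^ 2 / π * (-1 : ℝ) ^ r * ((a : ℝ) ^ 2 / (4 * π ^ 2)) ^ r
                          * (freq (a : ℝ) ((ii + 1 : ℕ) : ℤ) / (1 + 4 * freq (a : ℝ) ((ii + 1 : ℕ) : ℤ) ^ 2)))) r),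
                        fun _ ↦ 0, fun _ ↦ 0,
                        fun d : ℕ ↦ ∑ j ∈ (Finset.range J).filter (fun j ↦ (2 * j + 2) = d),
                        ((-1 : ℝ) ^ (ii + 1) * ((ii + 1 : ℕ) : ℝ) ^ (2 * j + 1)) / Real.pi] t) d) x.1 x.2| * (![(1 : ℝ), ((m₀ + 1 : ℕ) : ℝ), ∑ n ∈ weilPrimeIndex (a : ℝ), (Λ n : ℝ) / Real.sqrt n, ∑ n ∈ weilPrimeIndex (a : ℝ), (Λ n : ℝ) / Real.sqrt n] x.1) / ((m₀ + 1 : ℕ) : ℝ) ^ (x.2 : ℕ) else 0) ii) B 1 w o cc ρ XP :=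
  dataNear_of_checkRect hS (fun ii hii _ _ ↦ mem_oddRhoRowTBox hS ha (hX ii hii) hRemS hLam hRho) h

end CinfPrimRO

end Summit.RiemannHypothesis.RiemannHypothesis.Theorems.WeilFormatC
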